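import Literature.NumberTheory.Transcendental.BakerLinearFormPi
import Literature.NumberTheory.LFunctions.GeneralizedEulerConstants
import Literature.AlgebraicGeometry.Frobenioids.LogPrimesLinearIndependent
import HarnessLib

/-!
# Murty–Zaytseva 2013: the generalized Euler constants `γ(P)` are transcendental with at most one exception

Topic `Literature/NumberTheory/Transcendental`. Proofs only (no definitions, no named facts).

M. Ram Murty and A. Zaytseva, *Transcendence of generalized Euler constants*, Amer. Math. Monthly
120 (2013) 48–54 [MurtyZaytseva2013]; statement as reported by Lagarias, Bull. AMS 50 (2013),
Theorem 3.16.4: «In the infinite list of Diamond–Ford generalized Euler constants `γ(Ω)` where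
`Ω` runs over all finite subsets of primes (including the empty set), all numbers are
transcendental with at most one exception.» With Diamond–Ford's Proposition 1
`γ(Ω) = δ_Ω (γ + Σ_{p∈Ω} log p/(p−1))`, `δ_Ω = Π_{p∈Ω}(1 − 1/p)` (tree:
`DiamondFord.tendsto_riemannZeta_mul_prod_sub_div`, the constant term of `ζ(s)Π(1 − p^{−s})`), the
theorem is: for finite sets of primes `P ≠ Q`,
`γ(P)/δ_P − γ(Q)/δ_Q = Σ_{p∈P} log p/(p−1) − Σ_{q∈Q} log q/(q−1)` is a NON-TRIVIAL rational
combination of logarithms of primes, non-zero by unique factorisation (tree: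
`Frobenioids.linearIndependent_rat_log_primes`) and hence transcendental (Baker / Hermite–Lindemann;
tree: `sum_log_eq_zero_of_isAlgebraic`, `BakerLinearFormPi.lean`) — so `γ(P)` and `γ(Q)` are not
both algebraic: `transcendental_sum_log_div_sub`, `eq_of_isAlgebraic_generalizedEuler` (VALUE form)
and `eq_of_tendsto_of_isAlgebraic` (constant-term form). «If `γ` were algebraic then `γ(∅)` would
be the unique exceptional value» — `transcendental_generalizedEuler_of_isAlgebraic`.

Cell pub-zeta5 (HONEST FRAMING: systematic search; no irrationality claim unless certified): a
printed 2013 theorem made a kernel theorem on the tree's proved Baker theorem; nothing here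
concerns `ζ(5)` or decides the nature of `γ`.
-/

noncomputable section

open Complex Finset Filter Topology
open Literature.AlgebraicGeometry.Frobenioids (linearIndependent_rat_log_primes)

namespace Literature.NumberTheory.Transcendental

namespace MurtyZaytseva2013

/-! ### Rational relations among logarithms of primes -/

/-- A rational relation `Σ_{p∈S} c_p log p = 0` among logarithms of distinct primes is trivial
(unique factorisation; the tree's `linearIndependent_rat_log_primes`). [folklore] -/
private theorem eq_zero_of_sum_mul_log_eq_zero (S : Finset ℕ) (hS : ∀ p ∈ S, p.Prime) (c : ℕ → ℚ)
    (h : ∑ p ∈ S, (c p : ℝ) * Real.log p = 0) : ∀ p ∈ S, c p = 0 := by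
  classical
  intro p hp
  have hli := linearIndependent_iff'.mp linearIndependent_rat_log_primes
    (S.subtype Nat.Prime) (fun q => c q.1)
  have hsum : ∑ q ∈ S.subtype Nat.Prime, (fun q : Nat.Primes => c q.1) q • Real.log ((q : ℕ) : ℝ) = 0 := by
    have e : ∑ q ∈ S.subtype Nat.Prime, (fun q : Nat.Primes => c q.1) q • Real.log ((q : ℕ) : ℝ) =
        ∑ x ∈ S.filter Nat.Prime, (c x : ℝ) * Real.log x := by
      rw [← Finset.sum_subtype_eq_sum_filter]
      exact Finset.sum_congr rfl fun q _ => by rw [Rat.smul_def]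
    rw [e, Finset.filter_true_of_mem hS, h]
  exact hli hsum ⟨p, hS p hp⟩ (Finset.mem_subtype.2 hp)

/-- **`Σ_{p∈P} log p/(p−1) − Σ_{q∈Q} log q/(q−1)` is transcendental for finite sets of primes
`P ≠ Q`** (a non-trivial rational combination of logarithms of primes: non-zero by unique
factorisation, so transcendental by Baker's theorem). [cite: MurtyZaytseva2013, Theorem (via Lagarias2013 Thm 3.16.4)] -/
theorem transcendental_sum_log_div_sub {P Q : Finset ℕ} (hP : ∀ p ∈ P, p.Prime)
    (hQ : ∀ q ∈ Q, q.Prime) (hne : P ≠ Q) :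
    Transcendental ℚ (∑ p ∈ P, Real.log p / ((p : ℝ) - 1) - ∑ q ∈ Q, Real.log q / ((q : ℝ) - 1)) := by
  classical
  intro halg
  set S : Finset ℕ := P ∪ Q with hSdef
  have hS : ∀ p ∈ S, p.Prime := fun p hp => by
    rcases Finset.mem_union.1 hp with h | h
    · exact hP p h
    · exact hQ p h
  -- the rational coefficients
  let c : ℕ → ℚ := fun p => (if p ∈ P then 1 / ((p : ℚ) - 1) else 0) - (if p ∈ Q then 1 / ((p : ℚ) - 1) else 0)
  have hc : ∀ p ∈ S, (c p : ℝ) * Real.log p =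
      (if p ∈ P then Real.log p / ((p : ℝ) - 1) else 0) - (if p ∈ Q then Real.log p / ((p : ℝ) - 1) else 0) := by
    intro p _
    simp only [c]
    split_ifs <;> push_cast <;> ring
  have hD : ∑ p ∈ S, (c p : ℝ) * Real.log p =
      ∑ p ∈ P, Real.log p / ((p : ℝ) - 1) - ∑ q ∈ Q, Real.log q / ((q : ℝ) - 1) := by
    rw [Finset.sum_congr rfl hc, Finset.sum_sub_distrib, Finset.sum_ite_mem, Finset.sum_ite_mem,
      Finset.union_inter_cancel_left, Finset.union_inter_cancel_right]
  -- Baker: an algebraic value of the linear form forces it to vanish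
  have hpos : ∀ x : S, 0 < ((x : ℕ) : ℝ) := fun x => by exact_mod_cast (hS x x.2).pos
  have halgS : ∀ x : S, IsAlgebraic ℚ (((x : ℕ) : ℝ)) := fun x => isAlgebraic_nat _
  have hcalg : ∀ x : S, IsAlgebraic ℚ ((c x : ℚ) : ℂ) := fun x => by
    rw [← eq_ratCast (algebraMap ℚ ℂ)]; exact isAlgebraic_algebraMap _
  have hsumC : ∑ x : S, ((c x : ℚ) : ℂ) * ((Real.log ((x : ℕ) : ℝ) : ℝ) : ℂ) =
      (((∑ p ∈ S, (c p : ℝ) * Real.log p : ℝ)) : ℂ) := by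
    rw [Finset.sum_coe_sort S (fun p => ((c p : ℚ) : ℂ) * ((Real.log (p : ℝ) : ℝ) : ℂ))]
    push_cast
    rfl
  have halgC : IsAlgebraic ℚ (∑ x : S, ((c x : ℚ) : ℂ) * ((Real.log ((x : ℕ) : ℝ) : ℝ) : ℂ)) := by
    rw [hsumC, hD]
    exact halg.algebraMap
  have h0 := sum_log_eq_zero_of_isAlgebraic (ι := S) (fun x => ((x : ℕ) : ℝ)) hpos halgS hcalg halgC
  beta_reduce at h0
  rw [hsumC] at h0
  have h0R : ∑ p ∈ S, (c p : ℝ) * Real.log p = 0 := by exact_mod_cast h0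
  have hzero := eq_zero_of_sum_mul_log_eq_zero S hS c h0R
  -- but `c_p = ±1/(p−1) ≠ 0` on the symmetric difference, which is non-empty
  have hPQ : ∃ p, (p ∈ P ∧ p ∉ Q) ∨ (p ∈ Q ∧ p ∉ P) := by
    by_contra hcon
    apply hne
    ext p
    constructor
    · intro h
      by_contra h'
      exact hcon ⟨p, Or.inl ⟨h, h'⟩⟩
    · intro h
      by_contra h'
      exact hcon ⟨p, Or.inr ⟨h, h'⟩⟩
  obtain ⟨p, hp⟩ := hPQ
  have hpS : p ∈ S := by
    rcases hp with ⟨h, _⟩ | ⟨h, _⟩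
    · exact Finset.mem_union_left _ h
    · exact Finset.mem_union_right _ h
  have hp1 : (1 : ℚ) / ((p : ℚ) - 1) ≠ 0 := by
    have : (1 : ℚ) < p := by exact_mod_cast (hS p hpS).one_lt
    exact div_ne_zero one_ne_zero (by linarith)
  have := hzero p hpS
  rcases hp with ⟨h₁, h₂⟩ | ⟨h₁, h₂⟩
  · simp only [c, if_pos h₁, if_neg h₂, sub_zero] at this
    exact hp1 this
  · simp only [c, if_pos h₁, if_neg h₂, zero_sub, neg_eq_zero] at this
    exact hp1 this

/-! ### Murty–Zaytseva: at most one `γ(P)` is algebraic -/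

/-- `δ_P = Π_{p∈P}(1 − 1/p)` is a non-zero rational number (as a real). [folklore] -/
private theorem delta_isAlgebraic_ne_zero (P : Finset ℕ) (hP : ∀ p ∈ P, p.Prime) :
    IsAlgebraic ℚ (∏ p ∈ P, (1 - ((p : ℝ))⁻¹)) ∧ ∏ p ∈ P, (1 - ((p : ℝ))⁻¹) ≠ 0 := by
  refine ⟨?_, ?_⟩
  · have e : ∏ p ∈ P, (1 - ((p : ℝ))⁻¹) = ((∏ p ∈ P, (1 - ((p : ℚ))⁻¹) : ℚ) : ℝ) := by push_cast; rfl
    rw [e, ← eq_ratCast (algebraMap ℚ ℝ)]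
    exact isAlgebraic_algebraMap _
  · refine Finset.prod_ne_zero_iff.2 fun p hp => ?_
    have : (1 : ℝ) < p := by exact_mod_cast (hP p hp).one_lt
    have : ((p : ℝ))⁻¹ < 1 := inv_lt_one_of_one_lt₀ this
    linarith

/-- **Murty–Zaytseva 2013 (value form).** For finite sets of primes `P`, `Q`: if the generalized
Euler constants `γ(P) = δ_P(γ + Σ_{p∈P} log p/(p−1))` and `γ(Q)` are both algebraic then `P = Q` —
«all numbers `γ(Ω)` are transcendental with at most one exception».
[cite: MurtyZaytseva2013, Theorem (via Lagarias2013 Thm 3.16.4)] -/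
theorem eq_of_isAlgebraic_generalizedEuler {P Q : Finset ℕ} (hP : ∀ p ∈ P, p.Prime)
    (hQ : ∀ q ∈ Q, q.Prime)
    (h₁ : IsAlgebraic ℚ ((∏ p ∈ P, (1 - ((p : ℝ))⁻¹)) *
      (Real.eulerMascheroniConstant + ∑ p ∈ P, Real.log p / ((p : ℝ) - 1))))
    (h₂ : IsAlgebraic ℚ ((∏ q ∈ Q, (1 - ((q : ℝ))⁻¹)) *
      (Real.eulerMascheroniConstant + ∑ q ∈ Q, Real.log q / ((q : ℝ) - 1)))) : P = Q := by
  by_contra hne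
  obtain ⟨hδP, hδP0⟩ := delta_isAlgebraic_ne_zero P hP
  obtain ⟨hδQ, hδQ0⟩ := delta_isAlgebraic_ne_zero Q hQ
  have h₁' : IsAlgebraic ℚ (Real.eulerMascheroniConstant + ∑ p ∈ P, Real.log p / ((p : ℝ) - 1)) := by
    have := (hδP.inv).mul h₁
    rwa [inv_mul_cancel_left₀ hδP0] at this
  have h₂' : IsAlgebraic ℚ (Real.eulerMascheroniConstant + ∑ q ∈ Q, Real.log q / ((q : ℝ) - 1)) := by
    have := (hδQ.inv).mul h₂
    rwa [inv_mul_cancel_left₀ hδQ0] at this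
  refine transcendental_sum_log_div_sub hP hQ hne ?_
  have := h₁'.sub h₂'
  rwa [add_sub_add_left_eq_sub] at this

/-- **Murty–Zaytseva 2013, the exception clause**: «If `γ` were algebraic then `γ(∅)` would be the
unique exceptional value» — `γ` algebraic makes `γ(P)` transcendental for every non-empty finite set
of primes `P`. [cite: MurtyZaytseva2013, Theorem (via Lagarias2013 Thm 3.16.4)] -/
theorem transcendental_generalizedEuler_of_isAlgebraic {P : Finset ℕ} (hP : ∀ p ∈ P, p.Prime)
    (hPne : P.Nonempty) (hγ : IsAlgebraic ℚ Real.eulerMascheroniConstant) :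
    Transcendental ℚ ((∏ p ∈ P, (1 - ((p : ℝ))⁻¹)) *
      (Real.eulerMascheroniConstant + ∑ p ∈ P, Real.log p / ((p : ℝ) - 1))) := by
  intro h
  have hempty : IsAlgebraic ℚ ((∏ p ∈ (∅ : Finset ℕ), (1 - ((p : ℝ))⁻¹)) *
      (Real.eulerMascheroniConstant + ∑ p ∈ (∅ : Finset ℕ), Real.log p / ((p : ℝ) - 1))) := by
    simpa using hγ
  have := eq_of_isAlgebraic_generalizedEuler hP (fun q hq => by simp at hq) h hempty
  exact hPne.ne_empty this

/-- **Murty–Zaytseva 2013 (constant-term form).** If the constant terms at `s = 1` of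
`ζ(s)Π_{p∈P}(1 − p^{−s})` and of `ζ(s)Π_{q∈Q}(1 − q^{−s})` (Diamond–Ford's `γ(P)`, `γ(Q)`;
`DiamondFord.tendsto_riemannZeta_mul_prod_sub_div`) are both algebraic, then `P = Q`.
[cite: MurtyZaytseva2013, Theorem (via Lagarias2013 Thm 3.16.4)] -/
theorem eq_of_tendsto_of_isAlgebraic {P Q : Finset ℕ} (hP : ∀ p ∈ P, p.Prime)
    (hQ : ∀ q ∈ Q, q.Prime) {x y : ℂ}
    (hx : Tendsto (fun s : ℂ => riemannZeta s * ∏ p ∈ P, (1 - (p : ℂ) ^ (-s)) -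
        (∏ p ∈ P, (1 - (p : ℂ)⁻¹)) / (s - 1)) (𝓝[≠] 1) (𝓝 x))
    (hy : Tendsto (fun s : ℂ => riemannZeta s * ∏ q ∈ Q, (1 - (q : ℂ) ^ (-s)) -
        (∏ q ∈ Q, (1 - (q : ℂ)⁻¹)) / (s - 1)) (𝓝[≠] 1) (𝓝 y))
    (hxa : IsAlgebraic ℚ x) (hya : IsAlgebraic ℚ y) : P = Q := by
  have hx' := Literature.NumberTheory.LFunctions.DiamondFord.tendsto_riemannZeta_mul_prod_sub_div P
    fun p hp => (hP p hp).one_lt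
  have hy' := Literature.NumberTheory.LFunctions.DiamondFord.tendsto_riemannZeta_mul_prod_sub_div Q
    fun q hq => (hQ q hq).one_lt
  have ex : x = (((∏ p ∈ P, (1 - ((p : ℝ))⁻¹)) *
      (Real.eulerMascheroniConstant + ∑ p ∈ P, Real.log p / ((p : ℝ) - 1)) : ℝ) : ℂ) := by
    rw [tendsto_nhds_unique hx hx']
    push_cast
    rfl
  have ey : y = (((∏ q ∈ Q, (1 - ((q : ℝ))⁻¹)) *
      (Real.eulerMascheroniConstant + ∑ q ∈ Q, Real.log q / ((q : ℝ) - 1)) : ℝ) : ℂ) := by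
    rw [tendsto_nhds_unique hy hy']
    push_cast
    rfl
  rw [ex] at hxa
  rw [ey] at hya
  exact eq_of_isAlgebraic_generalizedEuler hP hQ
    ((isAlgebraic_algebraMap_iff (R := ℚ) (A := ℂ) Complex.ofReal_injective).mp hxa)
    ((isAlgebraic_algebraMap_iff (R := ℚ) (A := ℂ) Complex.ofReal_injective).mp hya)

end MurtyZaytseva2013

end Literature.NumberTheory.Transcendental
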